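import Literature.Topology.FourManifolds.DiscTheoremDiffeotopy
import Literature.Topology.FourManifolds.UnorientedDiscTheorem
import HarnessLib

/-!
# The disc theorem without orientation hypotheses, by a diffeotopy compactly supported in a
# prescribed connected open set

Topic `Literature/Topology/FourManifolds`; a brick for the fact seat of
`Literature.Topology.FourManifolds.Cobordism.Milnor1965_basisTheorem_slab` (one-slide step of
Milnor's Basis Theorem 7.6 on a slab, *Lectures on the h-cobordism theorem* (1965), PDF
pp. 50–52: the left-hand sphere `S_L(p₁)` and a transversal disc of `S_R(p₂)` in the level
`V₀` are brought into a common chart by an isotopy of the — possibly non-orientable — level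
`V₀` supported off the other spheres, which Lemma 4.7 then absorbs into the gradient-like
field).

The tree proves the disc theorem of Palais–Cerf–Hirsch in two forms: **oriented, with a
diffeotopy to the identity compactly supported inside a preconnected open `W`**
(`Literature.Topology.FourManifolds.exists_isCompactlyDiffeotopicToIdIn_apply_disc_eq`,
`DiscTheoremDiffeotopy.lean`), and **unoriented (up to a reflection `r`), with compact support
but without the isotopy**
(`Literature.Topology.FourManifolds.exists_diffeomorph_apply_disc_eq_or_reflect_cs`,
`UnorientedDiscTheorem.lean`).  This file proves the common refinement needed when the
ambient manifold carries no orientation and the diffeomorphism must be isotopic to the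
identity through stages supported in `W` (M. W. Hirsch, *Differential Topology* (1976), Ch. 8
§3, Thm. 3.1 with the remark following it, and Ch. 8 §1, Thms. 1.3–1.4 for the support;
A. Kosinski, *Differential Manifolds* (1993), III.(3.6)):

* `exists_isCompactlyDiffeotopicToIdIn_apply_disc_eq_local_of_det_pos` — the local
  straightening step with its diffeotopy: if `i' = Φ⁻¹` is a disc packaged as a full chart,
  `k` a disc with `k 0 = i' 0` and `det D(Φ ∘ k)(0) > 0`, then `H (i' y) = k y` for
  `‖y‖ ≤ ρ` for some `H` compactly diffeotopic to the identity inside any `W ⊇ range i'`;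
* `exists_isCompactlyDiffeotopicToIdIn_apply_disc_eq_or_reflect_local`,
  **`exists_isCompactlyDiffeotopicToIdIn_apply_disc_eq_or_reflect`** — for two discs
  `i, i' : ℝⁿ → M` in a preconnected open `W` of a Hausdorff `n`-manifold and any linear
  automorphism `r` of `ℝⁿ` with `det r < 0`, there is `f` compactly diffeotopic to the
  identity inside `W` with either `f (i y) = i' y` for all `‖y‖ ≤ 1` or `f (i (r y)) = i' y`
  for all `‖y‖ ≤ 1`.

The proofs are those of the two tree files verbatim, merged: point push inside `W`
(`Diffeomorph.exists_isCompactlyDiffeotopicToIdIn_apply_eq`), the sign of the Jacobian of the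
local map (`det_fderiv_chart_comp_disc_ne_zero`) deciding whether `i` or `i ∘ r` is
straightened, and the ambient contractions of the discs inside `W`
(`exists_isCompactlyDiffeotopicToIdIn_apply_disc_eq_disc_smul`).  Everything is proved; no
definitions, no named facts.

## References

* R. Palais, *Extending diffeomorphisms*, Proc. AMS 11 (1960) 274–277, Thm. B. [Palais1960]
* M. W. Hirsch, *Differential Topology*, GTM 33 (1976), Ch. 8 §1, Thms. 1.3–1.4; Ch. 8 §3,
  Thm. 3.1 and the remark following it. [HirschDT1976]
* J. Milnor, *Lectures on the h-cobordism theorem*, notes by L. Siebenmann and J. Sondow,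
  Princeton Mathematical Notes (1965), proof of Thm. 7.6 (PDF pp. 50–52).
  [MilnorHCobordism1965]
-/

open scoped Manifold ContDiff Topology
open Set Module Function Filter OpenPartialHomeomorph Metric

noncomputable section

namespace Literature.Topology.FourManifolds

section DiscTheorem

variable {n : ℕ}

variable {M : Type*} [TopologicalSpace M] [T2Space M] [ChartedSpace (EuclideanSpace ℝ (Fin n)) M]
  [IsManifold (𝓡 n) ∞ M]

omit [IsManifold (𝓡 n) ∞ M] in
/-- **Local straightening of a disc onto another with the same centre and positive relative
Jacobian, by a diffeomorphism compactly diffeotopic to the identity inside any `W ⊇ range i'`**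
(Hirsch, *Differential Topology* (1976), Ch. 8 §3, proof of Thm. 3.1, the steps after the
centres have been matched, with Ch. 8 §1 for the supports): let `i' = Φ⁻¹` be a disc packaged
as a full smooth chart `Φ`, and `k` a disc with `k 0 = i' 0` whose local map `F = Φ ∘ k` has
`det DF(0) > 0`.  Then `H (i' y) = k y` for `‖y‖ ≤ ρ`, some `ρ > 0`, with `H` compactly
diffeotopic to the identity inside `W`: straighten `DF(0) ∈ GL⁺` by a compactly diffeotopic `s`
(`isStraightenableIso_of_det_pos`), correct `s⁻¹ ∘ F` (tangent to the identity) by a compactly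
diffeotopic `G` (`exists_diffeomorph_diffeotopy_eq_of_fderiv_eq_id`), and transport `s ∘ G`
with its diffeotopy along `Φ` (`isCompactlyDiffeotopicToIdIn_chartTransportDiffeomorph`).
[cite: HirschDT1976, Ch. 8 §3, Thm. 3.1; Ch. 8 §1, Thms. 1.3–1.4] -/
theorem exists_isCompactlyDiffeotopicToIdIn_apply_disc_eq_local_of_det_pos
    {k i' : EuclideanSpace ℝ (Fin n) → M}
    (hk : Manifold.IsSmoothEmbedding 𝓘(ℝ, EuclideanSpace ℝ (Fin n)) (𝓡 n) ∞ k) (h0 : k 0 = i' 0)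
    {Φ : OpenPartialHomeomorph M (EuclideanSpace ℝ (Fin n))} (hΦt : Φ.target = univ)
    (hΦs : ⇑Φ.symm = i') (hΦsrc : Φ.source = range i')
    (hΦc : ContMDiffOn (𝓡 n) (𝓡 n) ∞ Φ Φ.source) (hΦ' : ContMDiff (𝓡 n) (𝓡 n) ∞ Φ.symm)
    (hpos : 0 < LinearMap.det ((fderiv ℝ (Φ ∘ k) 0 :
        (EuclideanSpace ℝ (Fin n)) →L[ℝ] (EuclideanSpace ℝ (Fin n))) :
      (EuclideanSpace ℝ (Fin n)) →ₗ[ℝ] (EuclideanSpace ℝ (Fin n))))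
    {W : Set M} (hi'W : range i' ⊆ W) :
    ∃ H : M ≃ₘ⟮𝓡 n, 𝓡 n⟯ M, Diffeomorph.IsCompactlyDiffeotopicToIdIn W H ∧
      ∃ ρ > (0 : ℝ), ∀ y : EuclideanSpace ℝ (Fin n), ‖y‖ ≤ ρ → H (i' y) = k y := by
  have h0src : k 0 ∈ Φ.source := by rw [h0, hΦsrc]; exact mem_range_self 0
  have hΦ0 : Φ (k 0) = 0 := by
    rw [h0, ← hΦs]; exact Φ.right_inv (by rw [hΦt]; trivial)
  -- the local map `F = Φ ∘ k`
  set V : Set (EuclideanSpace ℝ (Fin n)) := k ⁻¹' Φ.source with hV_def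
  have hV : IsOpen V := Φ.open_source.preimage hk.contMDiff.continuous
  have h0V : (0 : EuclideanSpace ℝ (Fin n)) ∈ V := h0src
  set F : (EuclideanSpace ℝ (Fin n)) → (EuclideanSpace ℝ (Fin n)) := Φ ∘ k with hF_def
  have hFs : ContMDiffOn (𝓡 n) (𝓡 n) ∞ F V :=
    hΦc.comp hk.contMDiff.contMDiffOn fun y hy => hy
  have hFc : ContDiffOn ℝ ∞ F V := contMDiffOn_iff_contDiffOn.mp hFs
  have hF0 : F 0 = 0 := hΦ0
  have hFd : DifferentiableAt ℝ F 0 :=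
    (hFc.contDiffAt (hV.mem_nhds h0V)).differentiableAt (by simp)
  set L : (EuclideanSpace ℝ (Fin n)) →L[ℝ] (EuclideanSpace ℝ (Fin n)) := fderiv ℝ F 0
    with hL_def
  have hL : 0 < LinearMap.det (L :
      (EuclideanSpace ℝ (Fin n)) →ₗ[ℝ] (EuclideanSpace ℝ (Fin n))) := hpos
  -- straighten `L` by a compactly diffeotopic `s`
  set Le : (EuclideanSpace ℝ (Fin n)) ≃L[ℝ] (EuclideanSpace ℝ (Fin n)) :=
    L.toContinuousLinearEquivOfDetNeZero hL.ne' with hLe_def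
  have hLe : (Le : (EuclideanSpace ℝ (Fin n)) →L[ℝ] (EuclideanSpace ℝ (Fin n))) = L :=
    L.coe_toContinuousLinearEquivOfDetNeZero hL.ne'
  obtain ⟨s, ρ₁, R₁, hρ₁, hs1, hs2, Ds, hDs1, hDs2⟩ :=
    isStraightenableIso_of_det_pos Le (by rw [hLe]; exact hL)
  have hs0 : s 0 = 0 := by rw [hs1 0 (by simp [hρ₁.le])]; simp
  have hs'0 : s.symm 0 = 0 := by
    have h := s.symm_apply_apply 0
    rwa [hs0] at h
  have hsL : HasFDerivAt s L 0 := by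
    have hev : (s : EuclideanSpace ℝ (Fin n) → EuclideanSpace ℝ (Fin n)) =ᶠ[𝓝 0] Le := by
      filter_upwards [closedBall_mem_nhds (0 : EuclideanSpace ℝ (Fin n)) hρ₁] with y hy
      exact hs1 y (by simpa using hy)
    rw [← hLe]
    exact (Le : (EuclideanSpace ℝ (Fin n)) →L[ℝ]
      (EuclideanSpace ℝ (Fin n))).hasFDerivAt.congr_of_eventuallyEq hev
  have hs'd : DifferentiableAt ℝ s.symm 0 :=
    (s.symm.contMDiff.contDiff.differentiable (by simp)) 0
  have hinv : (fderiv ℝ s.symm 0).comp L =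
      ContinuousLinearMap.id ℝ (EuclideanSpace ℝ (Fin n)) := by
    have h1 : HasFDerivAt (s.symm ∘ s) ((fderiv ℝ s.symm 0).comp L) 0 := by
      have h : HasFDerivAt s.symm (fderiv ℝ s.symm 0) (s 0) := by
        rw [hs0]; exact hs'd.hasFDerivAt
      exact h.comp 0 hsL
    have h2 : (s.symm : EuclideanSpace ℝ (Fin n) → EuclideanSpace ℝ (Fin n)) ∘ s = id :=
      funext fun y => s.symm_apply_apply y
    rw [h2] at h1
    exact h1.unique (hasFDerivAt_id 0)
  -- `s⁻¹ ∘ F` is tangent to the identity; straighten it by a compactly diffeotopic `G`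
  set F₂ : (EuclideanSpace ℝ (Fin n)) → (EuclideanSpace ℝ (Fin n)) := s.symm ∘ F with hF₂_def
  have hF₂c : ContDiffOn ℝ ∞ F₂ V := s.symm.contMDiff.contDiff.comp_contDiffOn hFc
  have hF₂0 : F₂ 0 = 0 := by simp [hF₂_def, hF0, hs'0]
  have hDF₂ : fderiv ℝ F₂ 0 = ContinuousLinearMap.id ℝ (EuclideanSpace ℝ (Fin n)) := by
    have h : HasFDerivAt s.symm (fderiv ℝ s.symm 0) (F 0) := by
      rw [hF0]; exact hs'd.hasFDerivAt
    have h2 : HasFDerivAt F₂ ((fderiv ℝ s.symm 0).comp L) 0 := h.comp 0 hFd.hasFDerivAt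
    rw [h2.fderiv, hinv]
  obtain ⟨r, hr, hrV, G, DG, hG1, hG2, hDG1, hDG2⟩ :=
    exists_diffeomorph_diffeotopy_eq_of_fderiv_eq_id hV h0V hF₂c hF₂0 hDF₂
  have hFG : ∀ y : EuclideanSpace ℝ (Fin n), ‖y‖ ≤ r → F y = s (G y) := fun y hy => by
    rw [hG1 y (by simpa using hy)]
    simp [hF₂_def]
  -- transport `T = s ∘ G` and its diffeotopy along `Φ`
  set T := G.trans s with hT_def
  have hT : ∀ y : EuclideanSpace ℝ (Fin n), max (2 * r) R₁ ≤ ‖y‖ → T y = y :=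
    fun y hy => by
    show s (G y) = y
    rw [hG2 y ((le_max_left _ _).trans hy), hs2 y ((le_max_right _ _).trans hy)]
  have hTD : ∃ D : Diffeotopy 𝓘(ℝ, EuclideanSpace ℝ (Fin n)) (EuclideanSpace ℝ (Fin n)),
      D.stage 1 = T ∧ ∃ R', ∀ t y, R' ≤ ‖y‖ → D.toFun t y = y := by
    refine ⟨DG.trans Ds, Diffeomorph.ext fun y => ?_, max (2 * r) R₁, fun t y hy => ?_⟩
    · rw [Diffeotopy.coe_stage, Diffeotopy.trans_toFun, hT_def, Diffeomorph.coe_trans,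
        Function.comp_apply, Function.comp_apply, ← Diffeotopy.coe_stage,
        ← Diffeotopy.coe_stage, hDG1, hDs1]
    · rw [Diffeotopy.trans_toFun, Function.comp_apply, hDG2 t y ((le_max_left _ _).trans hy),
        hDs2 t y ((le_max_right _ _).trans hy)]
  set H := chartTransportDiffeomorph hΦc hΦ' hΦt T hT with hH_def
  have hHd : Diffeomorph.IsCompactlyDiffeotopicToIdIn W H :=
    isCompactlyDiffeotopicToIdIn_chartTransportDiffeomorph hΦc hΦ' hΦt T hT hTD
      (fun x hx => hi'W (by rwa [hΦsrc] at hx))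
  refine ⟨H, hHd, r, hr, fun y hy => ?_⟩
  have h := chartTransportDiffeomorph_symm_apply hΦc hΦ' hΦt T hT y
  have e1 : Φ.symm y = i' y := by rw [hΦs]
  rw [e1] at h
  rw [h]
  show Φ.symm (s (G y)) = k y
  rw [← hFG y hy]
  exact Φ.left_inv (hrV (by simp; linarith [hy]))

/-- **Local disc theorem without orientations, by a diffeomorphism compactly diffeotopic to
the identity inside `W`** (Hirsch, *Differential Topology* (1976), Ch. 8 §3, Thm. 3.1 and the
remark after it; Kosinski, *Differential Manifolds* (1993), III.(3.6)): for two discs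
`i, i' : ℝⁿ → M` lying in a preconnected open `W` of a Hausdorff `n`-manifold and any linear
automorphism `r` of `ℝⁿ` with `det r < 0`, there are `f`, compactly diffeotopic to the
identity inside `W`, and `ρ > 0` with either `f (i y) = i' y` for `‖y‖ ≤ ρ` or
`f (i (r y)) = i' y` for `‖y‖ ≤ ρ`.  Point push inside `W`
(`Diffeomorph.exists_isCompactlyDiffeotopicToIdIn_apply_eq`); the Jacobian of the local map
`Φ ∘ f₁ ∘ i` (`Φ = (i')⁻¹`) is invertible (`det_fderiv_chart_comp_disc_ne_zero`); if it is
positive straighten `f₁ ∘ i`, otherwise `f₁ ∘ i ∘ r`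
(`exists_isCompactlyDiffeotopicToIdIn_apply_disc_eq_local_of_det_pos`).
[cite: HirschDT1976, Ch. 8 §3, Thm. 3.1; Ch. 8 §1, Thms. 1.3–1.4] -/
theorem exists_isCompactlyDiffeotopicToIdIn_apply_disc_eq_or_reflect_local
    {i i' : EuclideanSpace ℝ (Fin n) → M}
    (hi : Manifold.IsSmoothEmbedding 𝓘(ℝ, EuclideanSpace ℝ (Fin n)) (𝓡 n) ∞ i)
    (hi' : Manifold.IsSmoothEmbedding 𝓘(ℝ, EuclideanSpace ℝ (Fin n)) (𝓡 n) ∞ i')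
    (r : (EuclideanSpace ℝ (Fin n)) ≃L[ℝ] (EuclideanSpace ℝ (Fin n)))
    (hr : LinearMap.det (r.toLinearEquiv :
      (EuclideanSpace ℝ (Fin n)) →ₗ[ℝ] (EuclideanSpace ℝ (Fin n))) < 0)
    {W : Set M} (hWo : IsOpen W) (hWc : IsPreconnected W) (hiW : range i ⊆ W)
    (hi'W : range i' ⊆ W) :
    ∃ f : M ≃ₘ⟮𝓡 n, 𝓡 n⟯ M, Diffeomorph.IsCompactlyDiffeotopicToIdIn W f ∧ ∃ ρ > (0 : ℝ),
      (∀ y : EuclideanSpace ℝ (Fin n), ‖y‖ ≤ ρ → f (i y) = i' y) ∨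
        (∀ y : EuclideanSpace ℝ (Fin n), ‖y‖ ≤ ρ → f (i (r y)) = i' y) := by
  -- Step 1: move the centre inside `W`
  obtain ⟨f₁, hf₁d, hf₁⟩ :=
    Diffeomorph.exists_isCompactlyDiffeotopicToIdIn_apply_eq (n := n) hWo hWc
      (hiW (mem_range_self 0)) (hi'W (mem_range_self 0))
  set i₁ : EuclideanSpace ℝ (Fin n) → M := f₁ ∘ i with hi₁_def
  have hi₁ : Manifold.IsSmoothEmbedding 𝓘(ℝ, EuclideanSpace ℝ (Fin n)) (𝓡 n) ∞ i₁ :=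
    hi.diffeomorph_comp f₁
  have hi₁0 : i₁ 0 = i' 0 := hf₁
  -- Step 2: the chart `Φ = (i')⁻¹`
  obtain ⟨Φ, hΦt, hΦs, hΦsrc, hΦc⟩ := exists_chart_of_isSmoothEmbedding hi'
  have hΦ' : ContMDiff (𝓡 n) (𝓡 n) ∞ Φ.symm := by rw [hΦs]; exact hi'.contMDiff
  have h0src : i₁ 0 ∈ Φ.source := by rw [hi₁0, hΦsrc]; exact mem_range_self 0
  -- Step 3: the sign of the Jacobian of `Φ ∘ i₁` at `0`
  have hdet := det_fderiv_chart_comp_disc_ne_zero hi₁ hΦt hΦc hΦ' h0src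
  rcases lt_or_gt_of_ne hdet with hneg | hpos
  · -- negative: straighten the reflected disc `i₁ ∘ r`
    set k : EuclideanSpace ℝ (Fin n) → M := i₁ ∘ r with hk_def
    have hk : Manifold.IsSmoothEmbedding 𝓘(ℝ, EuclideanSpace ℝ (Fin n)) (𝓡 n) ∞ k :=
      hi₁.comp_diffeomorph r.toDiffeomorph
    have hk0 : k 0 = i' 0 := by simp [hk_def, hi₁0]
    have hkpos : 0 < LinearMap.det ((fderiv ℝ (Φ ∘ k) 0 :
        (EuclideanSpace ℝ (Fin n)) →L[ℝ] (EuclideanSpace ℝ (Fin n))) :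
        (EuclideanSpace ℝ (Fin n)) →ₗ[ℝ] (EuclideanSpace ℝ (Fin n))) := by
      -- `D(Φ ∘ i₁ ∘ r)(0) = D(Φ ∘ i₁)(0) ∘ r`
      set V : Set (EuclideanSpace ℝ (Fin n)) := i₁ ⁻¹' Φ.source with hV_def
      have hV : IsOpen V := Φ.open_source.preimage hi₁.contMDiff.continuous
      have h0V : (0 : EuclideanSpace ℝ (Fin n)) ∈ V := h0src
      have hFs : ContMDiffOn (𝓡 n) (𝓡 n) ∞ (Φ ∘ i₁) V :=
        hΦc.comp hi₁.contMDiff.contMDiffOn fun y hy => hy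
      have hFc : ContDiffOn ℝ ∞ (Φ ∘ i₁) V := contMDiffOn_iff_contDiffOn.mp hFs
      have hFd : DifferentiableAt ℝ (Φ ∘ i₁) 0 :=
        (hFc.contDiffAt (hV.mem_nhds h0V)).differentiableAt (by simp)
      have h1 : HasFDerivAt (Φ ∘ i₁) (fderiv ℝ (Φ ∘ i₁) 0) (r 0) := by
        rw [map_zero]; exact hFd.hasFDerivAt
      have h2 : HasFDerivAt (Φ ∘ k) ((fderiv ℝ (Φ ∘ i₁) 0).comp
          (r : (EuclideanSpace ℝ (Fin n)) →L[ℝ] (EuclideanSpace ℝ (Fin n)))) 0 :=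
        h1.comp 0 (r : (EuclideanSpace ℝ (Fin n)) →L[ℝ] (EuclideanSpace ℝ (Fin n))).hasFDerivAt
      have hcomp : (((fderiv ℝ (Φ ∘ i₁) 0).comp
          (r : (EuclideanSpace ℝ (Fin n)) →L[ℝ] (EuclideanSpace ℝ (Fin n))) :
          (EuclideanSpace ℝ (Fin n)) →L[ℝ] (EuclideanSpace ℝ (Fin n))) :
            (EuclideanSpace ℝ (Fin n)) →ₗ[ℝ] (EuclideanSpace ℝ (Fin n))) =
          ((fderiv ℝ (Φ ∘ i₁) 0 : (EuclideanSpace ℝ (Fin n)) →L[ℝ] (EuclideanSpace ℝ (Fin n))) :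
              (EuclideanSpace ℝ (Fin n)) →ₗ[ℝ] (EuclideanSpace ℝ (Fin n))).comp
            ((r : (EuclideanSpace ℝ (Fin n)) →L[ℝ] (EuclideanSpace ℝ (Fin n))) :
              (EuclideanSpace ℝ (Fin n)) →ₗ[ℝ] (EuclideanSpace ℝ (Fin n))) := rfl
      rw [h2.fderiv, hcomp, LinearMap.det_comp]
      exact mul_pos_of_neg_of_neg hneg hr
    obtain ⟨H, hHd, ρ, hρ, hH⟩ :=
      exists_isCompactlyDiffeotopicToIdIn_apply_disc_eq_local_of_det_pos hk hk0 hΦt hΦs hΦsrc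
        hΦc hΦ' hkpos hi'W
    refine ⟨f₁.trans H.symm, hf₁d.trans hHd.symm, ρ, hρ, Or.inr fun y hy => ?_⟩
    show H.symm (f₁ (i (r y))) = i' y
    rw [show f₁ (i (r y)) = k y from rfl, ← hH y hy, H.symm_apply_apply]
  · -- positive: straighten `i₁` itself
    obtain ⟨H, hHd, ρ, hρ, hH⟩ :=
      exists_isCompactlyDiffeotopicToIdIn_apply_disc_eq_local_of_det_pos hi₁ hi₁0 hΦt hΦs hΦsrc
        hΦc hΦ' hpos hi'W
    refine ⟨f₁.trans H.symm, hf₁d.trans hHd.symm, ρ, hρ, Or.inl fun y hy => ?_⟩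
    show H.symm (f₁ (i y)) = i' y
    rw [show f₁ (i y) = i₁ y from rfl, ← hH y hy, H.symm_apply_apply]

/-- **The disc theorem without orientations, by a diffeomorphism compactly diffeotopic to the
identity inside a prescribed preconnected open set** (R. Palais, *Extending diffeomorphisms*
(1960), Thm. B; Hirsch, *Differential Topology* (1976), Ch. 8 §3, Thm. 3.1 with the remark
following it, and Ch. 8 §1, Thms. 1.3–1.4 for the support; Kosinski, *Differential Manifolds*
(1993), III.(3.6): in a connected manifold two embedded discs are ambient isotopic up to
precomposition with a reflection): for two discs `i, i' : ℝⁿ → M` (smooth embeddings of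
`ℝⁿ`) in a Hausdorff smooth `n`-manifold, lying in a preconnected open `W`, and any linear
automorphism `r` of `ℝⁿ` with `det r < 0`, there is a diffeomorphism `f` of `M`, compactly
diffeotopic to the identity inside `W`, with EITHER `f (i y) = i' y` for all `‖y‖ ≤ 1` OR
`f (i (r y)) = i' y` for all `‖y‖ ≤ 1`.  From the local theorem by the ambient contractions of
the discs `i` (or `i ∘ r`) and `i'` inside `W`
(`exists_isCompactlyDiffeotopicToIdIn_apply_disc_eq_disc_smul`).  No orientation or
orientability hypothesis on `M`.
[cite: Palais1960, Thm. B] [cite: HirschDT1976, Ch. 8 §3, Thm. 3.1; Ch. 8 §1, Thms. 1.3–1.4] -/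
theorem exists_isCompactlyDiffeotopicToIdIn_apply_disc_eq_or_reflect
    {i i' : EuclideanSpace ℝ (Fin n) → M}
    (hi : Manifold.IsSmoothEmbedding 𝓘(ℝ, EuclideanSpace ℝ (Fin n)) (𝓡 n) ∞ i)
    (hi' : Manifold.IsSmoothEmbedding 𝓘(ℝ, EuclideanSpace ℝ (Fin n)) (𝓡 n) ∞ i')
    (r : (EuclideanSpace ℝ (Fin n)) ≃L[ℝ] (EuclideanSpace ℝ (Fin n)))
    (hr : LinearMap.det (r.toLinearEquiv :
      (EuclideanSpace ℝ (Fin n)) →ₗ[ℝ] (EuclideanSpace ℝ (Fin n))) < 0)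
    {W : Set M} (hWo : IsOpen W) (hWc : IsPreconnected W) (hiW : range i ⊆ W)
    (hi'W : range i' ⊆ W) :
    ∃ f : M ≃ₘ⟮𝓡 n, 𝓡 n⟯ M, Diffeomorph.IsCompactlyDiffeotopicToIdIn W f ∧
      ((∀ y : EuclideanSpace ℝ (Fin n), ‖y‖ ≤ 1 → f (i y) = i' y) ∨
        (∀ y : EuclideanSpace ℝ (Fin n), ‖y‖ ≤ 1 → f (i (r y)) = i' y)) := by
  obtain ⟨f₀, hf₀d, ρ, hρ, hf₀⟩ :=
    exists_isCompactlyDiffeotopicToIdIn_apply_disc_eq_or_reflect_local hi hi' r hr hWo hWc hiW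
      hi'W
  set ρ' := min ρ 1 with hρ'_def
  have hρ' : 0 < ρ' := lt_min hρ one_pos
  have hρ'ρ : ρ' ≤ ρ := min_le_left _ _
  have hρy : ∀ y : EuclideanSpace ℝ (Fin n), ‖y‖ ≤ 1 → ‖ρ' • y‖ ≤ ρ := fun y hy => by
    rw [norm_smul, Real.norm_of_nonneg hρ'.le]
    calc ρ' * ‖y‖ ≤ ρ' * 1 := by gcongr
      _ ≤ ρ := by rw [mul_one]; exact hρ'ρ
  obtain ⟨K', hK'd, hK'⟩ :=
    exists_isCompactlyDiffeotopicToIdIn_apply_disc_eq_disc_smul hi' hρ' hi'W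
  rcases hf₀ with h | h
  · obtain ⟨K, hKd, hK⟩ :=
      exists_isCompactlyDiffeotopicToIdIn_apply_disc_eq_disc_smul hi hρ' hiW
    refine ⟨K.trans (f₀.trans K'.symm), hKd.trans (hf₀d.trans hK'd.symm),
      Or.inl fun y hy => ?_⟩
    show K'.symm (f₀ (K (i y))) = i' y
    rw [hK y hy, h _ (hρy y hy), ← hK' y hy, K'.symm_apply_apply]
  · have hir : Manifold.IsSmoothEmbedding 𝓘(ℝ, EuclideanSpace ℝ (Fin n)) (𝓡 n) ∞ (i ∘ r) :=
      hi.comp_diffeomorph r.toDiffeomorph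
    have hirW : range (i ∘ r) ⊆ W := (range_comp_subset_range _ _).trans hiW
    obtain ⟨K, hKd, hK⟩ :=
      exists_isCompactlyDiffeotopicToIdIn_apply_disc_eq_disc_smul hir hρ' hirW
    refine ⟨K.trans (f₀.trans K'.symm), hKd.trans (hf₀d.trans hK'd.symm),
      Or.inr fun y hy => ?_⟩
    show K'.symm (f₀ (K (i (r y)))) = i' y
    have e1 : K (i (r y)) = i (r (ρ' • y)) := by
      have := hK y hy
      simpa only [Function.comp_apply, map_smul] using this
    rw [e1, h _ (hρy y hy), ← hK' y hy, K'.symm_apply_apply]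

end DiscTheorem

end Literature.Topology.FourManifolds

end
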